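import Literature.AlgebraicGeometry.Modules.CechOrderedRawDegreeOne
import Literature.Algebra.Homology.HOneMkQOfQuasiIso
import Literature.AlgebraicGeometry.Modules.ModuleCechPrune
import Mathlib.LinearAlgebra.Dimension.Basic
import HarnessLib

/-!
# `Ȟ¹` of the ORDERED module Čech complex of `𝒪_X` is the all-ordered-pairs `CechH1` (The Stacks Project, Tags 01FG, 01FM, 01ED)

Topic `AlgebraicGeometry/Modules`; namespace `Literature.AlgebraicGeometry.Modules`.  THEOREMS ONLY (no definition, no named fact, no instance, no
notation, no `sorry`).  Cell `hodgecm-mathlib` (D-0151), P6 «MOD programme», junction (J10-iv) of the «H1-DIM-ANY-CHAR cut» (B-p04 (g42), memo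
`MEMO-H1DIM-cut.v4`), FILE 1b, sequel of ★ `Modules/CechOrderedRawDegreeOne` (`edgeRestrict`, `vertexRestrict`, `edgeExtend`): the dictionary
between the two degree-one Čech currencies of the tree —

* the ORDERED module Čech complex ★ `Modules.cechComplex 𝓤 (unitModule X) ρ` (scalars through any `ρ : R → Γ(X, 𝒪_X)`), read in degree one in
  the map-`mkQ` spelling `(ker d¹²).map (im d⁰¹).mkQ` of the Grothendieck-complex ∕ base-change files (★ `Modules/CechComplexBaseChangeHmkQ`);
* the ALL-ORDERED-PAIRS Čech group ★ `Morphisms.CechH1 f 𝓤` of an `A`-scheme `f : X → Spec A` (★ `cechH1_finite_holds`, ★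
  `CechH1AffineCoverIndependence`, ★ `CechH1FlatBaseChangeRank`, the abelian-variety count `dim Ȟ¹(A, 𝒪_A) = dim A`).

For EVERY scheme `X`, every family of opens `𝓤` on a linearly ordered index type and every ring map `σ : A → R` with `ρ ∘ σ = f♯` (the two
scalar actions), restriction to increasing pairs induces a `σ`-SEMILINEAR BIJECTION `Ȟ¹(𝓤, 𝒪_X) → H¹(Č_ord(𝓤, 𝒪_X; ρ))` ([StacksProject,
Tag 01FM] in degree one: a `1`-cocycle on all pairs is the alternating extension of its restriction, and the alternating extension of an ordered
cocycle is a cocycle; no affineness, no covering condition):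

* §1 `res_toRing_sub_sub_add_eq_zero_of_sysD_eq_zero` — the ordered cocycle identity `y_{jk}| - y_{ik}| + y_{ij}| = 0` on any `W ≤ U_{ {i,j,k} }`, read
  as functions; §2 **`cechD1_edgeExtend_eq_zero`** — the alternating extension of an ordered `1`-cocycle is a raw `1`-cocycle (13 position cases);
* §3 **`exists_cechH1_semilinear_HOne_bijective`** and its readings: **`nonempty_cechH1_linearEquiv_HOne_cechComplex`** (`σ = id`:
  `CechH1 f 𝓤 ≃ₗ[A] H¹_mkQ(Č_ord)`), `finrank_cechH1_eq_finrank_HOne_cechComplex_of_ringEquiv` (a ring ISOMORPHISM of scalars: equal `finrank`,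
  `Module.Finite` simultaneously) and **`finrank_HOne_cechComplex_appTop_eq_finrank_cechH1`** (`ρ = f.appTop`, scalars `Γ(Spec A, 𝒪) ≅ A` — the
  form produced by ★ (J10-iii-a) `finrank_HmkQ_baseChangeComplex_eq_of_isPullback`); §4 `finrank_HOne_cechComplex_eq_of_iso_unitModule` (a module
  `M ≅ 𝒪_X`, ★ `sectionsSystemIsoOfIso` + ★ `finrank_HmkQ_eq_of_quasiIso`).

HC_CM is proved only modulo the printed citations until rung 0 closes; nothing here is about HC (count-neutral ★ capital).

## References
* [StacksProject] The Stacks Project, Tag 01FG and Tag 01FM (ordered∕alternating versus full Čech complex), Tag 01ED (Čech cohomology).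
* [GortzWedhorn2023] U. Görtz, T. Wedhorn, *Algebraic Geometry II* (2023), Def. 21.64 (p. 179), Def. 21.68 (p. 180), Thm. 22.9 (p. 236).
* [Hartshorne1977] R. Hartshorne, *Algebraic Geometry* (1977), III §4, Lemma 4.4 and Thm. 4.5 (pp. 220–222).
-/

noncomputable section

set_option backward.isDefEq.respectTransparency false -- `ModuleCat`-valued functors (as in ★ `OrderedCechSystem`)

open CategoryTheory AlgebraicGeometry TopologicalSpace Opposite
open Literature.Algebra.Homology Literature.Algebra.Homology.OrderedCech Literature.AlgebraicGeometry.Morphisms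

universe u

namespace Literature.AlgebraicGeometry.Modules

variable {A : Type u} [CommRing A] {X : Scheme.{u}} (f : X ⟶ Spec (.of A))
  {R : Type u} [CommRing R] (ρ : R →+* Γ(X, ⊤)) {ι : Type} [LinearOrder ι] (U : ι → X.Opens)

/-! ## §1 The ordered cocycle identity on a triple, read as functions -/

/-- `{i < j < k}` has three elements. [cite: GortzWedhorn2023, Def. 21.68 (p. 180)] -/
theorem card_triple_eq_three {i j k : ι} (hij : i < j) (hjk : j < k) : ({i, j, k} : Finset ι).card = 3 := by
  rw [Finset.card_insert_of_notMem, Finset.card_pair hjk.ne]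
  simp only [Finset.mem_insert, Finset.mem_singleton, not_or]
  exact ⟨hij.ne, (hij.trans hjk).ne⟩

omit [LinearOrder ι] in
/-- `{j,k} ⊆ {i,j,k}`. [cite: GortzWedhorn2023, Def. 21.68 (p. 180)] -/
theorem pair_subset_triple₂₃ [DecidableEq ι] (i j k : ι) : ({j, k} : Finset ι) ⊆ {i, j, k} :=
  Finset.subset_insert _ _

omit [LinearOrder ι] in
/-- `{i,k} ⊆ {i,j,k}`. [cite: GortzWedhorn2023, Def. 21.68 (p. 180)] -/
theorem pair_subset_triple₁₃ [DecidableEq ι] (i j k : ι) : ({i, k} : Finset ι) ⊆ {i, j, k} :=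
  Finset.insert_subset_insert _ (Finset.subset_insert _ _)

omit [LinearOrder ι] in
/-- `{i,j} ⊆ {i,j,k}`. [cite: GortzWedhorn2023, Def. 21.68 (p. 180)] -/
theorem pair_subset_triple₁₂ [DecidableEq ι] (i j k : ι) : ({i, j} : Finset ι) ⊆ {i, j, k} :=
  Finset.insert_subset_insert _ (Finset.singleton_subset_iff.2 (by simp))

/-- The value `y.ext0At {p,q} t` of an ordered `1`-cochain, read as a function: `y_{pq}|_{U_t}`. [cite: GortzWedhorn2023, Def. 21.68 (p. 180)] -/
theorem toRing_ext0At_pair (y : OrderedCech.SysCochain (sectionsSystem U (unitModule X) ρ) 1) {p q : ι} (hpq : p < q) {t : Finset ι}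
    (h : ({p, q} : Finset ι) ⊆ t) :
    SecMod.toRing ρ (y.ext0At {p, q} t) = X.presheaf.map (homOfLE (cechOpen_anti U h)).op (SecMod.toRing ρ (y (edge p q hpq))) := by
  have hv := OrderedCech.SysCochain.ext0At_val y (edge p q hpq) t h
  change SecMod.toRing ρ (y.ext0At (edge p q hpq).1 t) = _
  rw [hv, toRing_sectionsSystem_map]
  rfl

omit [LinearOrder ι] in
/-- Composite restrictions read through `Sections.equiv`: `(T|_{V'})|_W = T|_W` in `Sections f W`. [cite: GortzWedhorn2023, Def. 21.64 (p. 179)] -/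
theorem res_sectionsEquiv_symm_map {V V' W : X.Opens} (h : V' ≤ V) (hW : W ≤ V') (T : Γ(X, V)) :
    Sections.res f hW ((Sections.equiv f V').symm (X.presheaf.map (homOfLE h).op T)) =
      Sections.res f (hW.trans h) ((Sections.equiv f V).symm T) := by
  change X.presheaf.map (homOfLE hW).op (X.presheaf.map (homOfLE h).op T) = X.presheaf.map (homOfLE (hW.trans h)).op T
  rw [← CommRingCat.comp_apply, ← Functor.map_comp]
  rfl

/-- **THE ORDERED COCYCLE IDENTITY, READ AS FUNCTIONS**: for an ordered `1`-cocycle `y` (`d y = 0`), `i < j < k` and any open `W ≤ U_{ {i,j,k} }`,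
`y_{jk}|_W - y_{ik}|_W + y_{ij}|_W = 0` in `Γ(X, W)`. [cite: GortzWedhorn2023, Def. 21.68 (p. 180)] [cite: StacksProject, Tag 01FG] -/
theorem res_toRing_sub_sub_add_eq_zero_of_sysD_eq_zero (y : OrderedCech.SysCochain (sectionsSystem U (unitModule X) ρ) 1)
    (hy : OrderedCech.sysD (sectionsSystem U (unitModule X) ρ) 1 y = 0) {i j k : ι} (hij : i < j) (hjk : j < k) {W : X.Opens}
    (hW : W ≤ cechOpen U {i, j, k}) :
    Sections.res f (hW.trans (cechOpen_anti U (pair_subset_triple₂₃ i j k)))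
        ((Sections.equiv f _).symm (SecMod.toRing ρ (y (edge j k hjk)))) -
      Sections.res f (hW.trans (cechOpen_anti U (pair_subset_triple₁₃ i j k)))
        ((Sections.equiv f _).symm (SecMod.toRing ρ (y (edge i k (hij.trans hjk))))) +
      Sections.res f (hW.trans (cechOpen_anti U (pair_subset_triple₁₂ i j k)))
        ((Sections.equiv f _).symm (SecMod.toRing ρ (y (edge i j hij)))) = 0 := by
  have hik : i < k := hij.trans hjk
  let τ : Simplex ι 2 := ⟨{i, j, k}, Finset.insert_nonempty _ _, by rw [card_triple_eq_three hij hjk]; norm_num⟩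
  have h0 : OrderedCech.sysD (sectionsSystem U (unitModule X) ρ) 1 y τ = 0 := by rw [hy]; rfl
  rw [OrderedCech.sysD_one_apply_triple y τ hij hjk rfl] at h0
  have h1 := congrArg (SecMod.toRing ρ) h0
  rw [toRing_obj_add, toRing_obj_sub, toRing_obj_zero,
    toRing_ext0At_pair ρ U y hjk (pair_subset_triple₂₃ i j k),
    toRing_ext0At_pair ρ U y hik (pair_subset_triple₁₃ i j k),
    toRing_ext0At_pair ρ U y hij (pair_subset_triple₁₂ i j k)] at h1
  have h2 := congrArg (fun x => Sections.res f hW ((Sections.equiv f (cechOpen U {i, j, k})).symm x)) h1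
  simp only [map_add, map_sub, map_zero] at h2
  rw [res_sectionsEquiv_symm_map, res_sectionsEquiv_symm_map, res_sectionsEquiv_symm_map] at h2
  exact h2

/-! ## §2 The alternating extension of an ordered `1`-cocycle is a raw `1`-cocycle -/

/-- `edgeExtend y` on an increasing pair, restricted to any `W ≤ U_i ∩ U_j`. [cite: StacksProject, Tag 01FM] -/
theorem res_edgeExtend_of_lt (y : OrderedCech.SysCochain (sectionsSystem U (unitModule X) ρ) 1) {i j : ι} (hij : i < j)
    {W : X.Opens} (hW : W ≤ U i ⊓ U j) :
    Sections.res f hW (edgeExtend f ρ U y i j) =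
      Sections.res f (hW.trans (inf_le_cechOpen_pair' U i j)) ((Sections.equiv f _).symm (SecMod.toRing ρ (y (edge i j hij)))) := by
  rw [edgeExtend_apply_of_lt f ρ U y hij, Sections.res_res]

/-- `edgeExtend y` on a decreasing pair, restricted to any `W ≤ U_i ∩ U_j`. [cite: StacksProject, Tag 01FM] -/
theorem res_edgeExtend_of_gt (y : OrderedCech.SysCochain (sectionsSystem U (unitModule X) ρ) 1) {i j : ι} (hji : j < i)
    {W : X.Opens} (hW : W ≤ U i ⊓ U j) :
    Sections.res f hW (edgeExtend f ρ U y i j) =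
      -Sections.res f (hW.trans (inf_le_cechOpen_pair_comm U i j)) ((Sections.equiv f _).symm (SecMod.toRing ρ (y (edge j i hji)))) := by
  rw [edgeExtend_apply_of_gt f ρ U y hji, map_neg, Sections.res_res]

/-- `edgeExtend y` on the diagonal, restricted. [cite: StacksProject, Tag 01FM] -/
theorem res_edgeExtend_self (y : OrderedCech.SysCochain (sectionsSystem U (unitModule X) ρ) 1) (i : ι) {W : X.Opens}
    (hW : W ≤ U i ⊓ U i) : Sections.res f hW (edgeExtend f ρ U y i i) = 0 := by
  rw [edgeExtend_apply_self, map_zero]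

omit [LinearOrder ι] in
/-- `U_a ∩ U_b ∩ U_c ≤ U_s` for any `s` whose members are among `a, b, c` (the permuted triples). [cite: GortzWedhorn2023, Def. 21.64 (p. 179)] -/
theorem inf₃_le_cechOpen_of_forall_mem (a b c : ι) (s : Finset ι) (hs : ∀ l ∈ s, l = a ∨ l = b ∨ l = c) :
    U a ⊓ U b ⊓ U c ≤ cechOpen U s :=
  Finset.le_inf fun l hl => by
    rcases hs l hl with rfl | rfl | rfl
    · exact inf_le_left.trans inf_le_left
    · exact inf_le_left.trans inf_le_right
    · exact inf_le_right

/-- **THE ALTERNATING EXTENSION OF AN ORDERED `1`-COCYCLE IS A RAW `1`-COCYCLE**: `d¹ (edgeExtend y) = 0` if `d y = 0` — on `(a, b, c)` the raw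
cocycle expression is `±` the ordered cocycle identity at the sorted triple (six orderings) or cancels (coincident indices).
[cite: StacksProject, Tag 01FM] [cite: GortzWedhorn2023, Def. 21.68 (p. 180)] -/
theorem cechD1_edgeExtend_eq_zero (y : OrderedCech.SysCochain (sectionsSystem U (unitModule X) ρ) 1)
    (hy : OrderedCech.sysD (sectionsSystem U (unitModule X) ρ) 1 y = 0) : cechD1 f U (edgeExtend f ρ U y) = 0 := by
  have OC := fun {i j k : ι} (hij : i < j) (hjk : j < k) {W : X.Opens} (hW : W ≤ cechOpen U {i, j, k}) =>
    res_toRing_sub_sub_add_eq_zero_of_sysD_eq_zero f ρ U y hy hij hjk hW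
  have mem3 : ∀ (p q r l : ι), l ∈ ({p, q, r} : Finset ι) → l = p ∨ l = q ∨ l = r := fun p q r l hl => by
    simpa only [Finset.mem_insert, Finset.mem_singleton] using hl
  funext a b c
  rw [cechD1_apply, Pi.zero_apply, Pi.zero_apply, Pi.zero_apply]
  rcases lt_trichotomy a b with hab | rfl | hba
  · rcases lt_trichotomy b c with hbc | rfl | hcb
    · -- `a < b < c`
      rw [res_edgeExtend_of_lt f ρ U y hbc, res_edgeExtend_of_lt f ρ U y (hab.trans hbc), res_edgeExtend_of_lt f ρ U y hab]
      exact OC hab hbc (inf₃_le_cechOpen_of_forall_mem U a b c _ (mem3 a b c))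
    · -- `a < b = c`
      rw [res_edgeExtend_self, res_edgeExtend_of_lt f ρ U y hab]
      abel
    · rcases lt_trichotomy a c with hac | rfl | hca
      · -- `a < c < b`
        rw [res_edgeExtend_of_gt f ρ U y hcb, res_edgeExtend_of_lt f ρ U y hac, res_edgeExtend_of_lt f ρ U y hab]
        have h := OC hac hcb (inf₃_le_cechOpen_of_forall_mem U a b c _ fun l hl => by have := mem3 a c b l hl; tauto)
        linear_combination -h
      · -- `a = c < b`
        rw [res_edgeExtend_of_gt f ρ U y hab, res_edgeExtend_self, res_edgeExtend_of_lt f ρ U y hab]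
        abel
      · -- `c < a < b`
        rw [res_edgeExtend_of_gt f ρ U y hcb, res_edgeExtend_of_gt f ρ U y hca, res_edgeExtend_of_lt f ρ U y hab]
        have h := OC hca hab (inf₃_le_cechOpen_of_forall_mem U a b c _ fun l hl => by have := mem3 c a b l hl; tauto)
        linear_combination h
  · -- `a = b`
    rw [res_edgeExtend_self]
    abel
  · rcases lt_trichotomy b c with hbc | rfl | hcb
    · rcases lt_trichotomy a c with hac | rfl | hca
      · -- `b < a < c`
        rw [res_edgeExtend_of_lt f ρ U y hbc, res_edgeExtend_of_lt f ρ U y hac, res_edgeExtend_of_gt f ρ U y hba]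
        have h := OC hba hac (inf₃_le_cechOpen_of_forall_mem U a b c _ fun l hl => by have := mem3 b a c l hl; tauto)
        linear_combination -h
      · -- `b < a = c`
        rw [res_edgeExtend_of_lt f ρ U y hba, res_edgeExtend_self, res_edgeExtend_of_gt f ρ U y hba]
        abel
      · -- `b < c < a`
        rw [res_edgeExtend_of_lt f ρ U y hbc, res_edgeExtend_of_gt f ρ U y hca, res_edgeExtend_of_gt f ρ U y hba]
        have h := OC hbc hca (inf₃_le_cechOpen_of_forall_mem U a b c _ fun l hl => by have := mem3 b c a l hl; tauto)
        linear_combination h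
    · -- `b = c < a`
      rw [res_edgeExtend_self, res_edgeExtend_of_gt f ρ U y hba]
      abel
    · -- `c < b < a`
      rw [res_edgeExtend_of_gt f ρ U y hcb, res_edgeExtend_of_gt f ρ U y (hcb.trans hba), res_edgeExtend_of_gt f ρ U y hba]
      have h := OC hcb hba (inf₃_le_cechOpen_of_forall_mem U a b c _ fun l hl => by have := mem3 c b a l hl; tauto)
      linear_combination -h

/-! ## §3 The comparison `Ȟ¹(𝓤, 𝒪_X) → H¹(Č_ord(𝓤, 𝒪_X; ρ))` -/

section Comparison

omit [LinearOrder ι] in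
/-- Restriction along `V ≤ V` is the identity (private copy of ★ `Motives.CartierDivisor.map_homOfLE_refl`). [folklore] -/
private theorem map_homOfLE_refl' {V : X.Opens} (h : V ≤ V) (x : Γ(X, V)) : X.presheaf.map (homOfLE h).op x = x := by
  rw [show homOfLE h = 𝟙 V from Subsingleton.elim _ _, op_id, X.presheaf.map_id]
  rfl

/-- Every ordered `0`-cochain is the vertex restriction of a raw `0`-cochain (`U_{ {i} } = U_i`). [cite: StacksProject, Tag 01FG] -/
theorem exists_vertexRestrict_eq (g : OrderedCech.SysCochain (sectionsSystem U (unitModule X) ρ) 0) :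
    ∃ b : CechC0 f U, vertexRestrict f ρ U b = g := by
  refine ⟨fun i => Sections.res f (cechOpen_singleton U i).ge ((Sections.equiv f _).symm (SecMod.toRing ρ (g (vertex i)))), ?_⟩
  funext τ
  obtain ⟨i, rfl⟩ := exists_eq_vertex τ
  apply SecMod.toRing_injective ρ
  rw [toRing_vertexRestrict_vertex, Sections.res_res]
  exact map_homOfLE_refl' _ _

variable (σ : A →+* R) (hσ : ∀ a, ρ (σ a) = algebraMapΓ f a)

include hσ in
/-- **RESTRICTION TO INCREASING PAIRS IS A `σ`-SEMILINEAR BIJECTION `Ȟ¹(𝓤, 𝒪_X) → H¹(Č_ord(𝓤, 𝒪_X; ρ))`** (degree-one case of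
[StacksProject, Tag 01FM]): for every scheme `X`, every `A`-structure `f : X → Spec A`, every ring map `σ : A → R` with `ρ ∘ σ = f♯` and every
linearly ordered family of opens `𝓤`, the map `[c] ↦ [c|_{i<j}]` from the all-ordered-pairs Čech group `CechH1 f 𝓤` to the degree-one cohomology
`(ker d¹²).map (im d⁰¹).mkQ` of `Modules.cechComplex 𝓤 (unitModule X) ρ` is well defined, `σ`-semilinear and bijective (injective: a raw cocycle is the
alternating extension of its restriction, ★ `edgeExtend_edgeRestrict`; surjective: ★ `cechD1_edgeExtend_eq_zero`, `edgeRestrict_edgeExtend`).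
[cite: StacksProject, Tag 01FM] [cite: GortzWedhorn2023, Def. 21.68 (p. 180)] -/
theorem exists_cechH1_semilinear_HOne_bijective :
    ∃ Φ : CechH1 f U →ₛₗ[σ] ↥((LinearMap.ker ((cechComplex U (unitModule X) ρ).d 1 2).hom).map
        (LinearMap.range ((cechComplex U (unitModule X) ρ).d 0 1).hom).mkQ),
      Function.Bijective Φ ∧ ∀ z : ↥(cechZ1 f U),
        ((Φ (CechH1.mk f U z) : _) : ((cechComplex U (unitModule X) ρ).X 1) ⧸ LinearMap.range ((cechComplex U (unitModule X) ρ).d 0 1).hom) =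
          (LinearMap.range ((cechComplex U (unitModule X) ρ).d 0 1).hom).mkQ (edgeRestrict f ρ U (z : CechC1 f U)) := by
  -- the semilinear restriction of `1`-cochains
  let r : CechC1 f U →ₛₗ[σ] ((cechComplex U (unitModule X) ρ).X 1) :=
    { toFun := edgeRestrict f ρ U
      map_add' := map_add (edgeRestrict f ρ U)
      map_smul' := edgeRestrict_smul f ρ U σ hσ }
  have hr : ∀ c, r c = edgeRestrict f ρ U c := fun _ => rfl
  set d01 := ((cechComplex U (unitModule X) ρ).d 0 1).hom with hd01
  set d12 := ((cechComplex U (unitModule X) ρ).d 1 2).hom with hd12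
  have hd01g : ∀ g, d01 g = OrderedCech.sysD (sectionsSystem U (unitModule X) ρ) 0 g := cechComplex_d_zero_one_apply U (unitModule X) ρ
  have hd12g : ∀ g, d12 g = OrderedCech.sysD (sectionsSystem U (unitModule X) ρ) 1 g := cechComplex_d_one_two_apply U (unitModule X) ρ
  -- cocycles to classes
  let ψ : ↥(cechZ1 f U) →ₛₗ[σ] ((cechComplex U (unitModule X) ρ).X 1) ⧸ LinearMap.range d01 :=
    (LinearMap.range d01).mkQ.comp (r.comp (cechZ1 f U).subtype)
  have hψ : ∀ z : ↥(cechZ1 f U), ψ z = (LinearMap.range d01).mkQ (edgeRestrict f ρ U (z : CechC1 f U)) := fun _ => rfl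
  -- coboundaries go to zero
  have hB : (cechB1 f U).comap (cechZ1 f U).subtype ≤ LinearMap.ker ψ := by
    intro z hz
    obtain ⟨b, hb⟩ := (mem_cechB1_iff f U _).1 hz
    rw [LinearMap.mem_ker, hψ, Submodule.mkQ_apply, Submodule.Quotient.mk_eq_zero, LinearMap.mem_range]
    exact ⟨vertexRestrict f ρ U b, by rw [hd01g, ← edgeRestrict_cechD0, hb]; rfl⟩
  let Φ₀ : CechH1 f U →ₛₗ[σ] ((cechComplex U (unitModule X) ρ).X 1) ⧸ LinearMap.range d01 :=
    ((cechB1 f U).comap (cechZ1 f U).subtype).liftQ ψ hB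
  have hΦ₀ : ∀ z : ↥(cechZ1 f U), Φ₀ (CechH1.mk f U z) = (LinearMap.range d01).mkQ (edgeRestrict f ρ U (z : CechC1 f U)) :=
    fun z => by rw [CechH1.mk, Submodule.mkQ_apply]; exact Submodule.liftQ_apply _ _ _
  -- values are classes of cocycles
  have hmem : ∀ x, Φ₀ x ∈ (LinearMap.ker d12).map (LinearMap.range d01).mkQ := by
    intro x
    obtain ⟨z, rfl⟩ := CechH1.mk_surjective f U x
    rw [hΦ₀]
    refine Submodule.mem_map_of_mem ?_
    rw [LinearMap.mem_ker, hd12g]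
    exact sysD_edgeRestrict_eq_zero f ρ U _ ((mem_cechZ1_iff f U _).1 z.2)
  refine ⟨Φ₀.codRestrict _ hmem, ⟨?_, ?_⟩, fun z => ?_⟩
  · -- injective: a raw cocycle whose restriction is an ordered coboundary is a raw coboundary
    refine (injective_iff_map_eq_zero _).2 fun x hx => ?_
    obtain ⟨z, rfl⟩ := CechH1.mk_surjective f U x
    have hx' : Φ₀ (CechH1.mk f U z) = 0 := congrArg Subtype.val hx
    rw [hΦ₀, Submodule.mkQ_apply, Submodule.Quotient.mk_eq_zero, LinearMap.mem_range] at hx'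
    obtain ⟨g, hg⟩ := hx'
    obtain ⟨b, hb⟩ := exists_vertexRestrict_eq f ρ U g
    have hz : cechD1 f U (z : CechC1 f U) = 0 := (mem_cechZ1_iff f U _).1 z.2
    have hdiff : edgeRestrict f ρ U ((z : CechC1 f U) - cechD0 f U b) = 0 := by
      rw [map_sub, edgeRestrict_cechD0, hb, ← hd01g, hg, sub_self]
    have hcoc : cechD1 f U ((z : CechC1 f U) - cechD0 f U b) = 0 := by rw [map_sub, hz, cechD1_cechD0, sub_zero]
    have key := edgeExtend_edgeRestrict f ρ U _ hcoc
    rw [hdiff, map_zero] at key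
    rw [CechH1.mk_eq_zero_iff, mem_cechB1_iff]
    exact ⟨b, (sub_eq_zero.1 key.symm).symm⟩
  · -- surjective: the alternating extension of an ordered cocycle
    rintro ⟨q, hq⟩
    obtain ⟨w, hw, hwq⟩ := Submodule.mem_map.1 hq
    have hw0 : OrderedCech.sysD (sectionsSystem U (unitModule X) ρ) 1 w = 0 := by rw [← hd12g]; exact hw
    have hzw : cechD1 f U (edgeExtend f ρ U w) = 0 := cechD1_edgeExtend_eq_zero f ρ U w hw0
    refine ⟨CechH1.mk f U ⟨edgeExtend f ρ U w, (mem_cechZ1_iff f U _).2 hzw⟩, Subtype.ext ?_⟩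
    change Φ₀ _ = q
    rw [hΦ₀, Subtype.coe_mk, edgeRestrict_edgeExtend, ← hwq]
  · change Φ₀ _ = _
    rw [hΦ₀]

/-- **`Ȟ¹(𝓤, 𝒪_X) ≃ₗ[A] H¹(Č_ord(𝓤, 𝒪_X; ρ))` when the two scalar actions agree** (`ρ = f♯` pointwise, `σ = id`).
[cite: StacksProject, Tag 01FM] [cite: GortzWedhorn2023, Def. 21.68 (p. 180)] -/
theorem nonempty_cechH1_linearEquiv_HOne_cechComplex (ρ : A →+* Γ(X, ⊤)) (hρ : ∀ a, ρ a = algebraMapΓ f a) (U : ι → X.Opens) :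
    Nonempty (CechH1 f U ≃ₗ[A] ↥((LinearMap.ker ((cechComplex U (unitModule X) ρ).d 1 2).hom).map
        (LinearMap.range ((cechComplex U (unitModule X) ρ).d 0 1).hom).mkQ)) := by
  obtain ⟨Φ, hΦ, -⟩ := exists_cechH1_semilinear_HOne_bijective f ρ U (RingHom.id A) (fun a => hρ a)
  exact ⟨LinearEquiv.ofBijective Φ hΦ⟩

omit [LinearOrder ι] in
/-- Finite generation passes along an additive bijection compatible with a map of scalar rings (plumbing for the two-rings reading).
[cite: GortzWedhorn2023, Def. 21.68 (p. 180)] -/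
theorem moduleFinite_of_addEquiv_of_smul_eq {S : Type*} [Semiring S] {M N : Type*} [AddCommGroup M] [Module A M]
    [AddCommGroup N] [Module S N] (i : A → S) (j : M ≃+ N)
    (hc : ∀ (a : A) (m : M), j (a • m) = i a • j m) [Module.Finite A M] : Module.Finite S N := by
  obtain ⟨T, hT⟩ := Module.Finite.fg_top (R := A) (M := M)
  classical
  refine ⟨⟨T.image j, ?_⟩⟩
  rw [eq_top_iff]
  rintro n -
  obtain ⟨m, rfl⟩ := j.surjective n
  have hm : m ∈ Submodule.span A (T : Set M) := by rw [hT]; trivial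
  refine Submodule.span_induction (p := fun m _ => j m ∈ Submodule.span S (↑(T.image j) : Set N)) ?_ ?_ ?_ ?_ hm
  · intro x hx
    exact Submodule.subset_span (by rw [Finset.coe_image]; exact Set.mem_image_of_mem _ hx)
  · rw [map_zero]; exact zero_mem _
  · intro x y _ _ hx hy
    rw [map_add]; exact add_mem hx hy
  · intro a x _ hx
    rw [hc]; exact Submodule.smul_mem _ _ hx

/-- **TWO RINGS OF SCALARS**: for a ring ISOMORPHISM `e : R ≃+* A` with `f♯ ∘ e = ρ`, `Ȟ¹(𝓤, 𝒪_X)` (an `A`-module through `f`) and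
`H¹(Č_ord(𝓤, 𝒪_X; ρ))` (an `R`-module through `ρ`) have the same `finrank`, and are finite simultaneously (Mathlib `rank_eq_of_equiv_equiv`
along the semilinear bijection). [cite: StacksProject, Tag 01FM] [cite: GortzWedhorn2023, Def. 21.68 (p. 180)] -/
theorem finrank_cechH1_eq_finrank_HOne_cechComplex_of_ringEquiv (e : R ≃+* A) (he : ∀ r, algebraMapΓ f (e r) = ρ r) :
    Module.finrank A (CechH1 f U) = Module.finrank R ↥((LinearMap.ker ((cechComplex U (unitModule X) ρ).d 1 2).hom).map
        (LinearMap.range ((cechComplex U (unitModule X) ρ).d 0 1).hom).mkQ) ∧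
      (Module.Finite A (CechH1 f U) ↔ Module.Finite R ↥((LinearMap.ker ((cechComplex U (unitModule X) ρ).d 1 2).hom).map
        (LinearMap.range ((cechComplex U (unitModule X) ρ).d 0 1).hom).mkQ)) := by
  have hσ : ∀ a, ρ (e.symm a) = algebraMapΓ f a := fun a => by rw [← he, e.apply_symm_apply]
  obtain ⟨Φ, hΦ, -⟩ := exists_cechH1_semilinear_HOne_bijective f ρ U (e.symm : A →+* R) hσ
  let j := AddEquiv.ofBijective Φ.toAddMonoidHom hΦ
  have hj : ∀ (a : A) x, j (a • x) = e.symm a • j x := fun a x => Φ.map_smulₛₗ a x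
  have hj' : ∀ (r : R) y, j.symm (r • y) = e r • j.symm y := fun r y => by
    apply j.injective
    rw [j.apply_symm_apply, hj, j.apply_symm_apply, e.symm_apply_apply]
  refine ⟨congrArg Cardinal.toNat (rank_eq_of_equiv_equiv (e.symm : A → R) j e.symm.bijective hj), ⟨fun _ => ?_, fun _ => ?_⟩⟩
  · exact moduleFinite_of_addEquiv_of_smul_eq (e.symm : A → R) j hj
  · exact moduleFinite_of_addEquiv_of_smul_eq (e : R → A) j.symm hj'

end Comparison

/-! ## §4 The readings consumed by the H1-DIM head: scalars `Γ(Spec A, 𝒪) ≅ A`; a module isomorphic to `𝒪_X` -/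

section Readings

/-- **`finrank` OF `H¹(Č_ord(𝓤, 𝒪_X; f.appTop))` OVER `Γ(Spec A, 𝒪)` EQUALS `finrank_A Ȟ¹(𝓤, 𝒪_X)`**, and the two are finite simultaneously — the
scalars of ★ (J10-iii-a) `finrank_HmkQ_baseChangeComplex_eq_of_isPullback` (base change to `B′ = Spec A`) versus those of ★ `Morphisms.CechH1 f 𝓤`
(`A` through `f♯ ∘ (ΓSpecIso A)⁻¹`), matched along `ΓSpecIso A : Γ(Spec A, 𝒪) ≅ A`. [cite: StacksProject, Tag 01FM] [cite: GortzWedhorn2023, Def. 21.68 (p. 180)] -/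
theorem finrank_HOne_cechComplex_appTop_eq_finrank_cechH1 (U : ι → X.Opens) :
    Module.finrank Γ(Spec (.of A), ⊤) ↥((LinearMap.ker ((cechComplex U (unitModule X) f.appTop.hom).d 1 2).hom).map
        (LinearMap.range ((cechComplex U (unitModule X) f.appTop.hom).d 0 1).hom).mkQ) = Module.finrank A (CechH1 f U) ∧
      (Module.Finite Γ(Spec (.of A), ⊤) ↥((LinearMap.ker ((cechComplex U (unitModule X) f.appTop.hom).d 1 2).hom).map
        (LinearMap.range ((cechComplex U (unitModule X) f.appTop.hom).d 0 1).hom).mkQ) ↔ Module.Finite A (CechH1 f U)) := by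
  have he : ∀ r : Γ(Spec (.of A), ⊤), algebraMapΓ f ((Scheme.ΓSpecIso (.of A)).commRingCatIsoToRingEquiv r) = f.appTop.hom r := by
    intro r
    change f.appTop.hom ((Scheme.ΓSpecIso (.of A)).inv ((Scheme.ΓSpecIso (.of A)).hom r)) = f.appTop.hom r
    rw [Iso.hom_inv_id_apply]
  obtain ⟨h1, h2⟩ := finrank_cechH1_eq_finrank_HOne_cechComplex_of_ringEquiv f f.appTop.hom U
    (Scheme.ΓSpecIso (.of A)).commRingCatIsoToRingEquiv he
  exact ⟨h1.symm, h2.symm⟩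

variable {M : X.Modules}

/-- **A MODULE ISOMORPHIC TO `𝒪_X` HAS THE SAME `H¹(Č_ord)` COUNT**: for `M ≅ unitModule X`, the ordered Čech complexes are isomorphic (★
`sectionsSystemIsoOfIso`), so the degree-one map-`mkQ` cohomologies are `R`-linearly isomorphic (★ `nonempty_HmkQ_linearEquiv_of_quasiIsoAt`).
[cite: GortzWedhorn2023, Def. 21.68 (p. 180)] [cite: StacksProject, Tag 0111] -/
theorem nonempty_HOne_cechComplex_linearEquiv_of_iso_unitModule [Fintype ι] (eM : M ≅ unitModule X) (U : ι → X.Opens) :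
    Nonempty (↥((LinearMap.ker ((cechComplex U M ρ).d 1 2).hom).map (LinearMap.range ((cechComplex U M ρ).d 0 1).hom).mkQ) ≃ₗ[R]
      ↥((LinearMap.ker ((cechComplex U (unitModule X) ρ).d 1 2).hom).map
        (LinearMap.range ((cechComplex U (unitModule X) ρ).d 0 1).hom).mkQ)) := by
  let Ψ : cechComplex U M ρ ≅ cechComplex U (unitModule X) ρ := sectionsSystemIsoOfIso U eM ρ
  haveI : QuasiIso Ψ.hom := inferInstance
  exact nonempty_HmkQ_linearEquiv_of_quasiIsoAt Ψ.hom 0 1 2 (by norm_num) (by norm_num)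

/-- The same as an equality of `finrank` and a simultaneous finiteness. [cite: GortzWedhorn2023, Def. 21.68 (p. 180)] [cite: StacksProject, Tag 0111] -/
theorem finrank_HOne_cechComplex_eq_of_iso_unitModule [Fintype ι] (eM : M ≅ unitModule X) (U : ι → X.Opens) :
    Module.finrank R ↥((LinearMap.ker ((cechComplex U M ρ).d 1 2).hom).map (LinearMap.range ((cechComplex U M ρ).d 0 1).hom).mkQ) =
      Module.finrank R ↥((LinearMap.ker ((cechComplex U (unitModule X) ρ).d 1 2).hom).map
        (LinearMap.range ((cechComplex U (unitModule X) ρ).d 0 1).hom).mkQ) ∧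
    (Module.Finite R ↥((LinearMap.ker ((cechComplex U M ρ).d 1 2).hom).map (LinearMap.range ((cechComplex U M ρ).d 0 1).hom).mkQ) ↔
      Module.Finite R ↥((LinearMap.ker ((cechComplex U (unitModule X) ρ).d 1 2).hom).map
        (LinearMap.range ((cechComplex U (unitModule X) ρ).d 0 1).hom).mkQ)) := by
  obtain ⟨e⟩ := nonempty_HOne_cechComplex_linearEquiv_of_iso_unitModule ρ eM U
  exact ⟨e.finrank_eq, ⟨fun _ => Module.Finite.equiv e, fun _ => Module.Finite.equiv e.symm⟩⟩

end Readings

end Literature.AlgebraicGeometry.Modules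

end
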